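import Literature.Geometry.Symplectic.OrigamiForm
import Literature.NumberTheory.Transcendental.FormsAlgebra
import HarnessLib

/-!
# The origami 4-sphere `(S⁴, ω₀|)` (Cannas da Silva–Guillemin–Pires 2010, Example 2.3)

Topic `Literature/Geometry/Symplectic`; part of cite item `wi-17594` (route
SmoothPoincare4/SymplecticOrigami). Companion to `OrigamiForm.lean` (`IsOrigamiForm`, Def. 2.1/2.2),
whose module docstring notes that the honest example `(S⁴, ω₀|_{S⁴})` is not built there.

A. Cannas da Silva, V. Guillemin, A. R. Pires, *Symplectic Origami*, IMRN 2011 = arXiv:0909.4065,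
§2.1, **Example 2.3** (read, `n = 2`): "Consider the unit sphere `S²ⁿ` in euclidean space
`ℝ²ⁿ⁺¹ ≃ ℂⁿ × ℝ` with coordinates `x₁, y₁, …, xₙ, yₙ, h`. Let `ω₀` be the restriction to `S²ⁿ` of
`dx₁ ∧ dy₁ + … + dxₙ ∧ dyₙ`. Then `ω₀` is a folded symplectic form. The folding hypersurface is the
equator sphere given by the intersection with the plane `h = 0`. The null foliation is the Hopf
foliation […] hence the null fibration is `S¹ ↪ S²ⁿ⁻¹ ↠ ℂℙⁿ⁻¹`. Thus, `(S²ⁿ, ω₀)` is an orientable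
origami manifold." (Example 2.6: cutting it produces `ℂℙⁿ` and `ℂℙⁿ`-bar with the same multiple of
the Fubini–Study form — not vendored: the cut pieces need carriers the tree does not have yet.)

## Content

* "restriction to `S⁴`" is the tree's pull-back of forms `MForm.pullback`
  (`Literature/NumberTheory/Transcendental/FormsAlgebra.lean`) along the inclusion `S⁴ ↪ ℝ⁵`.
* `presymplecticBilinFive`, `presymplecticAltFive`, `presymplecticMFormFive` — the constant 2-form
  `ω₀ = dx₁ ∧ dy₁ + dx₂ ∧ dy₂` on `ℝ⁵ = ℂ² × ℝ` (coordinates `(x₁, y₁, x₂, y₂, h)` = indices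
  `0, 1, 2, 3, 4`), built exactly like the tree's `stdSymplecticAlt` on `ℝ⁴`
  (`GromovR4RelEndProofs.lean`), with `presymplecticAltFive_apply`.
* `sphereOrigamiForm : MForm (𝓡 4) S⁴ ℝ 2` — its restriction (pullback along the inclusion) to the
  unit sphere `S⁴ ⊂ ℝ⁵`.
* NAMED FACT `CannasDaSilvaGuilleminPires2010_example_2_3` — Example 2.3 for `n = 2`:
  `sphereOrigamiForm` is an origami form (`IsOrigamiForm`) and its fold is the equator `{h = 0}`.

## Wording risks

* `IsOrigamiForm` (the tree's rendering of Def. 2.2) carries the folding hypersurface and the free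
  circle action as existential data and does not impose the orientation convention; Example 2.3
  supplies them as the equator `S³` with the Hopf action, so the printed example implies the fact
  as stated. The fold clause is the printed "intersection with the plane `h = 0`".
-/

noncomputable section

open scoped Manifold ContDiff Topology
open Set Function
open Literature.Geometry.Kaehler

namespace Literature.Geometry.Symplectic

/-- Local notation: `𝔼 n` is the model space `EuclideanSpace ℝ (Fin n)`. -/
local notation "𝔼" n:arg => EuclideanSpace ℝ (Fin n)

/-- Local notation: `𝕊 n` is the unit sphere in `EuclideanSpace ℝ (Fin (n + 1))`. -/
local notation "𝕊 " n:arg => (Metric.sphere (0 : EuclideanSpace ℝ (Fin (n + 1))) 1)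

/-! ### `ω₀ = dx₁ ∧ dy₁ + dx₂ ∧ dy₂` on `ℝ⁵ = ℂ² × ℝ` -/

/-- `ω₀ = dx₁ ∧ dy₁ + dx₂ ∧ dy₂` on `ℝ⁵` (coordinates `(x₁, y₁, x₂, y₂, h)` = indices `0,…,4`) as a
continuous bilinear map, assembled from the coordinate functionals.
[cite: CannasdasilvaGuilleminPires2010, Example 2.3 (ω₀ on ℂⁿ × ℝ)] -/
def presymplecticBilinFive : (𝔼 5) →L[ℝ] (𝔼 5) →L[ℝ] ℝ :=
  (EuclideanSpace.proj (0 : Fin 5)).smulRight (EuclideanSpace.proj (1 : Fin 5) : (𝔼 5) →L[ℝ] ℝ) -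
    (EuclideanSpace.proj (1 : Fin 5)).smulRight (EuclideanSpace.proj (0 : Fin 5) : (𝔼 5) →L[ℝ] ℝ) +
    (EuclideanSpace.proj (2 : Fin 5)).smulRight (EuclideanSpace.proj (3 : Fin 5) : (𝔼 5) →L[ℝ] ℝ) -
    (EuclideanSpace.proj (3 : Fin 5)).smulRight (EuclideanSpace.proj (2 : Fin 5) : (𝔼 5) →L[ℝ] ℝ)

/-- `presymplecticBilinFive a b = a₀b₁ - a₁b₀ + a₂b₃ - a₃b₂`. [folklore] -/
@[simp]
theorem presymplecticBilinFive_apply (a b : 𝔼 5) :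
    presymplecticBilinFive a b = a 0 * b 1 - a 1 * b 0 + a 2 * b 3 - a 3 * b 2 := by
  simp [presymplecticBilinFive]

/-- `ω₀` on `ℝ⁵` as a continuous alternating 2-form: the antisymmetrisation
`½ (B(v, w) - B(w, v))` of `B = presymplecticBilinFive` (already antisymmetric), built exactly as
the tree's `stdSymplecticAlt`. [cite: CannasdasilvaGuilleminPires2010, Example 2.3] -/
def presymplecticAltFive : (𝔼 5) [⋀^Fin 2]→L[ℝ] ℝ :=
  (2⁻¹ : ℝ) • ContinuousMultilinearMap.alternatization
    (ContinuousLinearMap.uncurryLeft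
      (((continuousMultilinearCurryFin1 ℝ (𝔼 5) ℝ).symm : ((𝔼 5) →L[ℝ] ℝ) →L[ℝ] _).comp
        presymplecticBilinFive))

/-- `presymplecticAltFive ![v, w] = v₀w₁ - v₁w₀ + v₂w₃ - v₃w₂`. [folklore] -/
@[simp]
theorem presymplecticAltFive_apply (v w : 𝔼 5) :
    presymplecticAltFive ![v, w] = v 0 * w 1 - v 1 * w 0 + v 2 * w 3 - v 3 * w 2 := by
  change (((2⁻¹ : ℝ) • ContinuousMultilinearMap.alternatization _ : (𝔼 5) [⋀^Fin 2]→L[ℝ] ℝ))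
    (show Fin 2 → (𝔼 5) from ![v, w]) = _
  rw [ContinuousAlternatingMap.smul_apply,
    ContinuousMultilinearMap.alternatization_apply_apply]
  have huniv : (Finset.univ : Finset (Equiv.Perm (Fin 2))) = {1, Equiv.swap 0 1} := by decide
  rw [huniv, Finset.sum_pair (by decide)]
  simp [Equiv.Perm.sign_swap', Units.smul_def]
  ring

/-- `ω₀` as a (constant) 2-form on the manifold `ℝ⁵`.
[cite: CannasdasilvaGuilleminPires2010, Example 2.3] -/
def presymplecticMFormFive : MForm 𝓘(ℝ, 𝔼 5) (𝔼 5) ℝ 2 := fun _ => presymplecticAltFive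

/-- **The origami form of the 4-sphere**: the restriction (pullback along the inclusion
`S⁴ ↪ ℝ⁵ = ℂ² × ℝ`) of `ω₀ = dx₁ ∧ dy₁ + dx₂ ∧ dy₂` to the unit sphere
(Cannas da Silva–Guillemin–Pires 2010, Example 2.3, `n = 2`).
[cite: CannasdasilvaGuilleminPires2010, Example 2.3] -/
def sphereOrigamiForm : MForm (𝓡 4) (𝕊 4) ℝ 2 :=
  presymplecticMFormFive.pullback (I' := 𝓘(ℝ, 𝔼 5)) (𝓡 4) (Subtype.val : (𝕊 4) → 𝔼 5)

/-- Evaluation of the origami form of `S⁴` on tangent vectors: `ω₀` of their images in `ℝ⁵`.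
[folklore] -/
theorem sphereOrigamiForm_apply (x : 𝕊 4) (v w : TangentSpace (𝓡 4) x) :
    sphereOrigamiForm x ![v, w] =
      presymplecticAltFive ![mfderiv (𝓡 4) 𝓘(ℝ, 𝔼 5) (Subtype.val : (𝕊 4) → 𝔼 5) x v,
        mfderiv (𝓡 4) 𝓘(ℝ, 𝔼 5) (Subtype.val : (𝕊 4) → 𝔼 5) x w] := by
  rw [sphereOrigamiForm, MForm.pullback_apply]
  congr 1
  funext i
  fin_cases i <;> rfl

/-- **Cannas da Silva–Guillemin–Pires 2010, Example 2.3 (`n = 2`) — `(S⁴, ω₀|)` is an origami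
manifold with fold the equator** (NAMED FACT, not proved here): the restriction of
`dx₁ ∧ dy₁ + dx₂ ∧ dy₂` to the unit sphere `S⁴ ⊂ ℂ² × ℝ` is an origami form in the sense of the
tree's `IsOrigamiForm` (Def. 2.2: folded — `ω ∧ ω ⋔ 0` along an embedded compact hypersurface,
maximal rank there — with null foliation the orbits of a free circle action: here the equator
`S³ = {h = 0}` with the Hopf action), and its fold (degeneracy locus) is the equator
`{x ∈ S⁴ | h(x) = 0}` ("The folding hypersurface is the equator sphere given by the intersection
with the plane `h = 0`. The null foliation is the Hopf foliation").
[cite: CannasdasilvaGuilleminPires2010, Example 2.3] -/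
def CannasDaSilvaGuilleminPires2010_example_2_3 : Prop :=
  IsOrigamiForm sphereOrigamiForm ∧
    fold sphereOrigamiForm = {x : 𝕊 4 | (x : 𝔼 5) 4 = 0}

end Literature.Geometry.Symplectic

end
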